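import Literature.NumberTheory.DiophantineGeometry.GeneralizedFermatTwoPowerCoefficientSerreWeightProofs
import Literature.NumberTheory.GaloisRepresentations.SerreWeightEqTwoShapesProofs
import Literature.NumberTheory.GaloisRepresentations.InertiaRootsOfUnity
import Literature.NumberTheory.EllipticCurves.SelmerCorankControlRatProofs
import Literature.NumberTheory.EllipticCurves.IsogenyFrobeniusTraceProofs
import Summits.BirchSwinnertonDyer.BirchSwinnertonDyer.Theorems.EisensteinPrimesFullDescentOrdinaryDet
import HarnessLib

/-!
# L0: an elliptic curve over `ℚ` with good reduction at an odd prime `p` and an inertia-stable line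
# in `E[p]` is ORDINARY at `p` (Serre 1972, §1.11 Prop. 12: supersingular `⇒ E[p]` is an `𝔽_{p²}`-line)

Cell `bsd-eis`, seat `bsd-line-x1-p1-w4` gen 6 (width seat on crux 2 `GoodLatticeBDPValue`,
stmt-BirchSwinnertonDyer-19032, line `halves` v21). ROUTE-FREE helper (`--supports` the crux) toward the
registered KERNEL stub `stub_fullDescentAtThreeOfRed` (Theorem T′: `p = 3 → Good W p → Red W p → FD(W, p)`):
step **L0** of the elementary `E[9]` road (w3 g4's memo `AN3-StubB-elementary-road.md` §2), the ordinarity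
input `p ∤ a_p` that every «at `p`» brick of the road (F3, F6, F7) takes as a hypothesis and that the stub's
binders (`Good`, `Red`; no `Anom`) do not carry. THEOREMS ONLY (no definition, no named fact, no `sorry`);
nothing here closes a stub or proves a summit statement.

* `Rat.not_dvd_frobeniusTraceAt_of_stable_line` — `W/ℚ` elliptic, `p` odd, `v` the place of `p`, good
  reduction at `v`, and a subgroup `Φ ≤ E[p]` of order `p` stable under the decomposition group `Γ_{ℚ_v}`
  (acting through `res : Γ_{ℚ_v} → Γ_ℚ`; e.g. `Γ_ℚ`-stable) ⟹ `p ∤ a_v`. Proof: if `p ∣ a_v` (supersingular, height 2), Serre's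
  injective additive map `θ : E[p] → k` with `θ(res σ • X) = ψ₂(σ) θ(X)` (tree THEOREM
  `WeierstrassCurve.exists_additive_equivariant_of_dvd_frobeniusTraceAt`, `ψ₂` the level-two fundamental
  character, `e(v|p) = f(v|p) = 1` over `ℚ`) reads the action of `σ ∈ I_{ℚ_v}` on a generator `X` of `Φ`,
  `res σ • X = c_σ • X`, as `ψ₂(σ) = c_σ ∈ 𝔽_p ⊆ k`; hence `ψ₂^{p−1} = 1`, contradicting
  `fundamentalCharacter_pow_eq_one_iff` (`ψ₂` has order exactly `p² − 1`).
* `Rat.not_dvd_frobeniusTraceAt_of_red`, `Rat.not_dvd_frobeniusTrace_of_red` — with `Red W p`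
  (`¬ HasIrreducibleModPGaloisRep`: a `Γ_ℚ`-stable `H ≤ E[p]`, `H ≠ ⊥, ⊤`, hence of order `p`) in place of
  `Φ`; the second in the prime-indexed currency of the stub (`[W.IsGloballyMinimal]`, `Good W p`,
  `W.frobeniusTrace p`).

References: [SerreInventiones1972] §1.11 Prop. 12 (b), §1.7, §1.3 Prop. 2; [Serre1987] §2.8 Prop. 4.
-/

set_option linter.dupNamespace false
set_option autoImplicit false

noncomputable section

open scoped Classical NNReal NumberField AddSubgroup
open NumberField IsDedekindDomain

namespace Summit.BirchSwinnertonDyer.BirchSwinnertonDyer.Theorems.FullDescentOrdinaryNine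

open _root_.WeierstrassCurve Literature.NumberTheory.EllipticCurves
  Literature.NumberTheory.GaloisRepresentations Field IsDedekindDomain.HeightOneSpectrum
  Rat.HeightOneSpectrum Literature.NumberTheory.DiophantineGeometry ValuativeRel
  Literature.NumberTheory.GaloisRepresentations.ModPGaloisRep
  Literature.NumberTheory.GaloisRepresentations.IsNonarchimedeanLocalField

/-- **The algebra of L0, abstractly.** Let `k` be a field of characteristic `p` (odd), `ψ : G →* kˣ`
a character with `ψ ^ e = 1 → p² − 1 ∣ e` (order exactly `p² − 1`, as the level-two fundamental
character), `θ : A → k` additive and injective on a subgroup `T` (Serre's embedding of `E[p]`), and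
`act : G → A → A` with `θ (act σ X) = ψ σ · θ X` on `T`. If some `X ∈ T`, `X ≠ 0`, spans a line stable under
every `act σ` (`act σ X = c • X`, `c ∈ ℕ`), then `ψ σ = c ∈ 𝔽_p` for all `σ`, so `ψ^{p−1} = 1` and
`p² − 1 ∣ p − 1`: contradiction. [cite: SerreInventiones1972, §1.11 Prop. 12 (b) (proof)] -/
theorem false_of_equivariant_stable_line {k : Type*} [Field k] (p : ℕ) [hp : Fact p.Prime] [CharP k p]
    (hp2 : p ≠ 2) {G : Type*} [Group G] (ψ : G →* kˣ) (hψ : ∀ e : ℕ, ψ ^ e = 1 → p ^ 2 - 1 ∣ e)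
    {A : Type*} [AddCommGroup A] (θ : A → k) (T : AddSubgroup A)
    (hadd : ∀ X ∈ T, ∀ Y ∈ T, θ (X + Y) = θ X + θ Y) (hinj : ∀ X ∈ T, θ X = 0 → X = 0)
    (act : G → A → A) (hequiv : ∀ σ : G, ∀ X ∈ T, θ (act σ X) = (ψ σ : k) * θ X)
    {X : A} (hXT : X ∈ T) (hX0 : X ≠ 0) (hline : ∀ σ : G, ∃ c : ℕ, act σ X = c • X) : False := by
  have hpp : p.Prime := hp.out
  -- `θ (c • X) = c * θ X`
  have hθ0 : θ 0 = 0 := by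
    have h := hadd 0 (zero_mem _) 0 (zero_mem _)
    rw [add_zero] at h
    exact left_eq_add.mp h
  have hθn : ∀ c : ℕ, θ (c • X) = (c : k) * θ X := by
    intro c
    induction c with
    | zero => rw [zero_nsmul, hθ0, Nat.cast_zero, zero_mul]
    | succ c ih => rw [succ_nsmul, hadd _ (AddSubgroup.nsmul_mem _ hXT c) X hXT, ih,
        Nat.cast_succ, add_mul, one_mul]
  -- Fermat in `k`
  have hF : ∀ c : ℕ, ((c : k)) ^ p = c := fun c ↦ by
    rw [← Nat.cast_pow, CharP.natCast_eq_natCast (R := k) (p := p)]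
    exact (ZMod.natCast_eq_natCast_iff _ _ _).mp (by rw [Nat.cast_pow, ZMod.pow_card])
  have hθX : θ X ≠ 0 := fun h ↦ hX0 (hinj X hXT h)
  -- `ψ σ = c`, so `ψ σ ^ p = ψ σ`
  have hψp : ∀ σ : G, (ψ σ : k) ^ p = ψ σ := by
    intro σ
    obtain ⟨c, hc⟩ := hline σ
    have h1 : (ψ σ : k) * θ X = (c : k) * θ X := by rw [← hequiv σ X hXT, hc, hθn]
    rw [mul_right_cancel₀ hθX h1, hF]
  have hψ1 : ψ ^ (p - 1) = 1 := by
    ext σ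
    rw [MonoidHom.pow_apply, MonoidHom.one_apply, Units.val_pow_eq_pow_val, Units.val_one]
    have h := hψp σ
    have hp1 : p = (p - 1) + 1 := (Nat.sub_add_cancel hpp.one_le).symm
    rw [hp1, pow_succ] at h
    exact (mul_eq_right₀ (ψ σ).ne_zero).mp h
  have hdvd := hψ (p - 1) hψ1
  have h3 : 3 ≤ p := lt_of_le_of_ne hpp.two_le (Ne.symm hp2)
  have hlt : 0 < p - 1 := by omega
  have hle := Nat.le_of_dvd hlt hdvd
  have : p ^ 2 - 1 > p - 1 := by
    have : p ^ 2 ≥ 3 * p := by nlinarith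
    omega
  omega

/-- **L0 (Serre 1972 §1.11 Prop. 12): an inertia-stable line in `E[p]` forces ordinary reduction.**
Let `W/ℚ` be an elliptic curve, `p` an odd prime, `v` the place of `ℚ` above `p`, of good reduction, and
`Φ ≤ E[p]` a subgroup of order `p` stable under the decomposition group `Γ_{ℚ_v}` (through
`res = absGaloisRestrict ℚ ℚ_v`; e.g. a `Γ_ℚ`-stable line). Then `p ∤ a_v` (`W.frobeniusTraceAt v`). If `p ∣ a_v`, Serre's injective
additive `ψ₂`-equivariant `θ : E[p] → k` (`exists_additive_equivariant_of_dvd_frobeniusTraceAt`) gives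
`ψ₂(σ) θ(X) = θ(res σ • X) = θ(c • X) = c θ(X)` for a generator `X` of `Φ`, so `ψ₂(σ) = c ∈ 𝔽_p` and
`ψ₂(σ)^p = ψ₂(σ)` for all `σ`; then `ψ₂^{p-1} = 1`, i.e. `p² − 1 ∣ p − 1`
(`fundamentalCharacter_pow_eq_one_iff`), absurd.
[cite: SerreInventiones1972, §1.11 Prop. 12 (b), §1.7, §1.3 Prop. 2] -/
theorem Rat.not_dvd_frobeniusTraceAt_of_stable_line (W : WeierstrassCurve ℚ) [W.IsElliptic]
    (p : ℕ) [hp : Fact p.Prime] (hp2 : p ≠ 2)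
    (v : HeightOneSpectrum (𝓞 ℚ)) (hpv : (p : 𝓞 ℚ) ∈ v.asIdeal) (hgood : W.HasGoodReductionAt v)
    {Φ : AddSubgroup (geomPoints W)} (hΦ : Φ ≤ geomTorsion W p) (hcard : Nat.card Φ = p)
    (hstab : ∀ (τ : absoluteGaloisGroup (v.adicCompletion ℚ)), ∀ x ∈ Φ,
      absGaloisRestrict ℚ (v.adicCompletion ℚ) τ • x ∈ Φ) :
    ¬ ((p : ℤ) ∣ W.frobeniusTraceAt v) := by
  classical
  intro hss
  have hpp : p.Prime := hp.out
  -- `e(v|p) = f(v|p) = 1` over `ℚ`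
  have hirr : Irreducible ((p : ℕ) : 𝒪[v.adicCompletion ℚ]) :=
    irreducible_natCast_valuativeInteger_adicCompletion_of_natCast_mem hpv
  have hq : residueFieldCard (v.adicCompletion ℚ) = p :=
    residueFieldCard_adicCompletion_eq_of_natCast_mem hpv
  have hgen := natCast_dvd_of_mem_maximalIdeal_adicCompletionIntegers (v := v) hpv
  -- the residue field `κ = S ⧸ 𝔓` of `ℚ̄_v`, a field of characteristic `p`; `ι = id`
  letI : Field (absIntegers 𝒪[v.adicCompletion ℚ] (v.adicCompletion ℚ) ⧸
      absMaximalIdeal (v.adicCompletion ℚ)) := Ideal.Quotient.field (absMaximalIdeal (v.adicCompletion ℚ))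
  have hpm : ((p : ℕ) : 𝒪[v.adicCompletion ℚ]) ∈ 𝓂[v.adicCompletion ℚ] :=
    (IsLocalRing.mem_maximalIdeal _).mpr (mem_nonunits_iff.mpr hirr.not_isUnit)
  have hpP : ((p : ℕ) : absIntegers 𝒪[v.adicCompletion ℚ] (v.adicCompletion ℚ)) ∈
      absMaximalIdeal (v.adicCompletion ℚ) := by
    have h' := Ideal.mem_map_of_mem
      (algebraMap 𝒪[v.adicCompletion ℚ] (absIntegers 𝒪[v.adicCompletion ℚ] (v.adicCompletion ℚ))) hpm
    rw [map_natCast] at h'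
    exact Ideal.le_radical h'
  haveI : CharP (absIntegers 𝒪[v.adicCompletion ℚ] (v.adicCompletion ℚ) ⧸
      absMaximalIdeal (v.adicCompletion ℚ)) p := by
    rw [CharP.charP_iff_prime_eq_zero hpp,
      ← map_natCast (Ideal.Quotient.mk (absMaximalIdeal (v.adicCompletion ℚ))),
      Ideal.Quotient.eq_zero_iff_mem]
    exact hpP
  set ι : absIntegers 𝒪[v.adicCompletion ℚ] (v.adicCompletion ℚ) ⧸ absMaximalIdeal (v.adicCompletion ℚ) →+*
      absIntegers 𝒪[v.adicCompletion ℚ] (v.adicCompletion ℚ) ⧸ absMaximalIdeal (v.adicCompletion ℚ) :=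
    RingHom.id _ with hιdef
  -- Serre's `θ` and the level-two fundamental character `ψ`
  obtain ⟨θ, hadd, hinj, hequiv⟩ := W.exists_additive_equivariant_of_dvd_frobeniusTraceAt p hp2 v hpv
    hgood hss hgen hirr hq ι
  set ψ : ↥(absInertia (v.adicCompletion ℚ)) →*
      (absIntegers 𝒪[v.adicCompletion ℚ] (v.adicCompletion ℚ) ⧸ absMaximalIdeal (v.adicCompletion ℚ))ˣ :=
    fundamentalCharacter (v.adicCompletion ℚ) 2 ι ((p : ℕ) : 𝒪[v.adicCompletion ℚ]) hirr with hψdef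
  have hι : Function.Injective ι := fun a b h ↦ h
  have hψ : ∀ e : ℕ, ψ ^ e = 1 → p ^ 2 - 1 ∣ e := fun e he ↦ by
    have h := (fundamentalCharacter_pow_eq_one_iff two_ne_zero ι hι _ hirr e).mp
      (by rw [← hψdef]; exact he)
    rwa [hq] at h
  -- a generator `X` of `Φ`
  haveI : Finite Φ := Nat.finite_of_card_ne_zero (by rw [hcard]; exact hpp.ne_zero)
  obtain ⟨X, hXΦ, hX0⟩ : ∃ X ∈ Φ, X ≠ 0 := by
    by_contra h
    simp only [not_exists, not_and, not_not] at h
    have hbot : Φ = ⊥ := (AddSubgroup.eq_bot_iff_forall _).mpr h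
    have h1 : Nat.card Φ = 1 := by rw [hbot]; exact AddSubgroup.card_bot
    rw [hcard] at h1
    exact hpp.one_lt.ne' h1
  have hXord : addOrderOf X = p := by
    refine addOrderOf_eq_prime ?_ hX0
    rw [← natCast_zsmul]
    exact mem_torsionBy_iff.mp (hΦ hXΦ)
  have hgenX : ∀ x ∈ Φ, ∃ c : ℕ, x = c • X := forall_mem_exists_nsmul_eq hpp.pos hcard hXΦ hXord
  refine false_of_equivariant_stable_line p hp2 ψ hψ θ (geomTorsion W p) hadd hinj
    (fun (σ : ↥(absInertia (v.adicCompletion ℚ))) (Y : geomPoints W) ↦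
      absGaloisRestrict ℚ (v.adicCompletion ℚ) (σ : absoluteGaloisGroup (v.adicCompletion ℚ)) • Y)
    (fun σ Y hY ↦ by rw [hψdef]; exact hequiv σ Y hY) (hΦ hXΦ) hX0 fun σ ↦ ?_
  obtain ⟨c, hc⟩ := hgenX _ (hstab (σ : absoluteGaloisGroup (v.adicCompletion ℚ)) X hXΦ)
  exact ⟨c, hc⟩

/-- **Ordinarity from reducibility (`Red`)**: `W/ℚ` elliptic, `p` odd, `v ∋ p` of good reduction, and
`E[p]` reducible (`¬ W.HasIrreducibleModPGaloisRep p`: some `Γ_ℚ`-stable subgroup `H ≤ E[p]` with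
`H ≠ ⊥, ⊤`, necessarily of order `p`) ⟹ `p ∤ a_v`. (`Rat.not_dvd_frobeniusTraceAt_of_stable_line` with
`Φ = H`, stable under all of `Γ_ℚ`.) [cite: SerreInventiones1972, §1.11 Prop. 12 (b)] -/
theorem Rat.not_dvd_frobeniusTraceAt_of_red (W : WeierstrassCurve ℚ) [W.IsElliptic]
    (p : ℕ) [hp : Fact p.Prime] (hp2 : p ≠ 2)
    (v : HeightOneSpectrum (𝓞 ℚ)) (hpv : (p : 𝓞 ℚ) ∈ v.asIdeal) (hgood : W.HasGoodReductionAt v)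
    (hred : ¬ W.HasIrreducibleModPGaloisRep p) :
    ¬ ((p : ℤ) ∣ W.frobeniusTraceAt v) := by
  have hpp : p.Prime := hp.out
  simp only [HasIrreducibleModPGaloisRep, not_forall] at hred
  obtain ⟨H, hH, hne⟩ := hred
  rw [not_or] at hne
  obtain ⟨hbot, htop⟩ := hne
  -- `#H = p`
  have hE : Nat.card (geomTorsion W p) = p ^ 2 :=
    card_torsionBy_eq_sq (E := W.baseChange (AlgebraicClosure ℚ)) (n := p) (by exact_mod_cast hpp.ne_zero)
  haveI : Finite (geomTorsion W p) :=
    Nat.finite_of_card_ne_zero (by rw [hE]; exact pow_ne_zero 2 hpp.ne_zero)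
  have hdvd : Nat.card H ∣ p ^ 2 := hE ▸ AddSubgroup.card_addSubgroup_dvd_card H
  obtain ⟨i, hi, hHi⟩ := (Nat.dvd_prime_pow hpp).mp hdvd
  have hcardH : Nat.card H = p := by
    interval_cases i
    · exact absurd (AddSubgroup.eq_bot_of_card_eq H (by rw [hHi, pow_zero])) hbot
    · rw [hHi, pow_one]
    · exact absurd (AddSubgroup.eq_top_of_card_eq H (by rw [hHi, hE])) htop
  -- the line `Φ = H` inside `E(ℚ̄)`
  set Φ : AddSubgroup (geomPoints W) := H.map (geomTorsion W p).subtype with hΦdef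
  have hΦle : Φ ≤ geomTorsion W p := by
    rintro _ ⟨x, _, rfl⟩
    exact x.2
  have hΦcard : Nat.card Φ = p := by
    rw [← hcardH]
    exact Nat.card_congr (H.equivMapOfInjective _ (geomTorsion W p).subtype_injective).toEquiv.symm
  refine Rat.not_dvd_frobeniusTraceAt_of_stable_line W p hp2 v hpv hgood hΦle hΦcard ?_
  rintro τ _ ⟨x, hx, rfl⟩
  exact ⟨absGaloisRestrict ℚ (v.adicCompletion ℚ) τ • x, hH _ x hx, AddSubgroup.torsionBy.coe_smul _ _⟩

/-- **The same in the prime-indexed currency of `stub_fullDescentAtThreeOfRed`**: for `W/ℚ` elliptic and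
globally minimal, `p` an odd prime with `W.HasGoodReductionAtPrime p` (`Good W p`) and
`¬ W.HasIrreducibleModPGaloisRep p` (`Red W p`): `p ∤ W.frobeniusTrace p`, i.e. good ORDINARY reduction at
`p` (`GoodOrd`; bridges `hasGoodReductionAt_of_hasGoodReductionAtPrime`, `frobeniusTraceAt_eq_frobeniusTrace`
at the place `v` of `p`, which exists: `primesEquiv`). [cite: SerreInventiones1972, §1.11 Prop. 12 (b)] -/
theorem Rat.not_dvd_frobeniusTrace_of_red (W : WeierstrassCurve ℚ) [W.IsElliptic] [W.IsGloballyMinimal]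
    (p : ℕ) [hp : Fact p.Prime] (hp2 : p ≠ 2) (hgood : W.HasGoodReductionAtPrime p)
    (hred : ¬ W.HasIrreducibleModPGaloisRep p) :
    ¬ ((p : ℤ) ∣ W.frobeniusTrace p) := by
  -- the place `v` of `p`
  set v : HeightOneSpectrum (𝓞 ℚ) := primesEquiv.symm ⟨p, hp.out⟩ with hvdef
  have hv : (primesEquiv v : ℕ) = p := by rw [hvdef, Equiv.apply_symm_apply]
  have hpv : (p : 𝓞 ℚ) ∈ v.asIdeal := by
    have h := natCast_natGenerator_mem v
    rwa [show natGenerator v = p from hv] at h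
  have hgood' : W.HasGoodReductionAt v := W.hasGoodReductionAt_of_hasGoodReductionAtPrime v hpv hgood
  have h := Rat.not_dvd_frobeniusTraceAt_of_red W p hp2 v hpv hgood' hred
  rwa [W.frobeniusTraceAt_eq_frobeniusTrace v, hv] at h

end Summit.BirchSwinnertonDyer.BirchSwinnertonDyer.Theorems.FullDescentOrdinaryNine

end
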